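import Literature.AnabelianGeometry.SemiGraphs.ArithTemperedGroupTopology
import Literature.AnabelianGeometry.SemiGraphs.SubgroupPresentationArithLevels
import HarnessLib

/-!
# [SemiAnbd] Prop 5.2 (iv) / Thm 5.4 producer T54-B: the arithmetic tempered group `Π^temp_𝔊` PACKAGED
# over the arithmetic level kernels (`exists_arithTemperedGroup_of_presentation`)

Mochizuki, *Semi-graphs of anabelioids*, Publ. RIMS **42** (2006), §5 Prop 5.2 (iii)(iv) p. 64
("`B^temp(𝔊)` is a connected temperoid … natural exact sequences `1 → Π^temp_𝒢 → Π^temp_𝔊 → Π_A → 1`"),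
Def 5.1 (i) p. 62, kurims `paper:url-f33ace170ff4`. [cite: MochizukiSemiAnbd2006, Prop 5.2 (iv), p. 64]

PROOF-ONLY packaging file of producer row T54-B (GAP-LEDGER G-w4d053-1; abc-iut-w4-d053, "packaging
`exists_arithTemperedGroup`", L3-lead rulings α5-4 / α6-6 / α9-1).  It COMPOSES the three landed thirds:

* GROUP (abc-iut-w4-d082, ArithTemperedGroupOfOuterAction.lean): the carrier
  `Π^temp_𝔊 := π₁^temp(𝒢) ⋊^out Π_A` with `ι`, `aug`, exactness, `ArithChartAction`;
* TOPOLOGY (abc-iut-L3-d2, TemperedExtension*.lean / ArithTemperedGroupTopology.lean: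
  `exists_arithTemperedGroup_of_kernelSeq`): a TEMPERED group topology glued from an antitone sequence
  of normal subgroups `K n` with open cofinal traces on `π₁^temp(𝒢)` (`hK1`, `hK3`) and open images in
  `Π_A` (`hK1'`);
* TOWER (abc-iut-L3-d4, SubgroupPresentationArithLevels.lean): the ARITHMETIC LEVEL KERNELS
  `levelKer L = ker (arithAct L) ⊓ ker σ ⊓ centralMod Φ L` of a subgroup presentation `P` of `𝒢.graph`
  over `π₁^temp(𝒢)` compatible with the outer action (`IsArithCompatible`), which are normal, antitone,
  contain the level along `ι` (`le_comap_levelKer` ⇒ `hK1`) and have COFINAL traces when one vertex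
  group is compact and the levels are cofinal (`comap_levelKer_cofinal` ⇒ `hK3`; centre-freeness from
  temp-slimness `temperedPiSlim_holds`, Hausdorffness from `IsTempered.separated`).

RESULT `exists_arithTemperedGroup_of_presentation`: for a tempered chart `c` of `𝒢` under the Prop 3.6
hypotheses (first countable `π₁^temp(𝒢)`), `Π_A` tempered, an outer action `ρ : Π_A → Out(π₁^temp 𝒢)`
with Def 5.1 (i) binders `hV`/`hE`/`hopen`, a presentation `P` compatible with the outer model
(`IsArithCompatible` for `Φ e := e.1.1`, `σ := baseAct ∘ aug`) with a compact vertex group, and an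
antitone cofinal sequence of open normal `Φ`-stable levels `N n` — the GAP's shape: a TEMPERED
`Π^temp_𝔊` with `ι` a closed embedding, `aug` open surjective, `range ι = ker aug`, and
`ArithChartAction`, MODULO the ONE continuity binder
`hK1' : ∀ n, IsOpen (aug (levelKer (N n)))` (Def 5.1 (i)(c) "the outer action is congruence-continuous",
reduced by abc-iut-L3-d2 / w4-d082 to `hρcong`).  Nothing here asserts a statement of the paper beyond
what is proved; typed ≠ proved; no side taken on [IUTchIII] Cor 3.12.
-/

namespace Literature.AnabelianGeometry.SemiGraphs

namespace ProfiniteSemiGraph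

open CategoryTheory Topology Filter
open Literature.AnabelianGeometry.EtaleTheta

universe u

variable {𝒢 : ProfiniteSemiGraph.{u}} (c : TemperedPiChart 𝒢)
  {PA : Type u} [Group PA] [TopologicalSpace PA] [IsTopologicalGroup PA]
  (ρ : PA →* TopOut c.G) (baseAct : PA →* Aut 𝒢.graph)

/-- **T54-B, PACKAGED over the arithmetic level kernels** ([SemiAnbd] Prop 5.2 (iv) p. 64 with Def 5.1
(i) p. 62): the GAP-LEDGER shape G-w4d053-1 — a TEMPERED `Π^temp_𝔊` in the universe of `𝒢` with
`ι : π₁^temp(𝒢) → Π^temp_𝔊` a closed embedding, `aug : Π^temp_𝔊 → Π_A` open surjective,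
`range ι = ker aug`, and Def 5.1 (i) on the chart — from the group third (abc-iut-w4-d082), the topology
third (abc-iut-L3-d2) and the level kernels of a compatible subgroup presentation (abc-iut-L3-d4),
MODULO the continuity binder `hK1'` (open images of the level kernels in `Π_A`).
[cite: MochizukiSemiAnbd2006, Prop 5.2 (iv), p. 64] -/
theorem exists_arithTemperedGroup_of_presentation [FirstCountableTopology c.G]
    (h36 : 𝒢.Prop36Hypotheses) (hA : IsTempered PA)
    (hV : ∀ (a : PA) (v : 𝒢.graph.Vertex) (H : Subgroup c.G), H ∈ verticialSubgroups c v →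
      ∃ φ : contMulAut c.G, TopOut.mk c.G φ = ρ a ∧
        H.map (φ : MulAut c.G).toMonoidHom ∈ verticialSubgroups c ((baseAct a).hom.vertexMap v))
    (hE : ∀ (a : PA) (e : 𝒢.graph.Edge) (K : Subgroup c.G), K ∈ edgeLikeSubgroups c e →
      ∃ φ : contMulAut c.G, TopOut.mk c.G φ = ρ a ∧
        K.map (φ : MulAut c.G).toMonoidHom ∈ edgeLikeSubgroups c ((baseAct a).hom.edgeMap e))
    (hopen : ∃ U : Subgroup PA, IsOpen (U : Set PA) ∧ ∀ a ∈ U,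
      (∀ v, (baseAct a).hom.vertexMap v = v) ∧ (∀ e, (baseAct a).hom.edgeMap e = e) ∧
        ∀ b, (baseAct a).hom.branchMap b = b)
    (P : SemiGraph.SubgroupPresentation 𝒢.graph c.G)
    (hP : P.IsArithCompatible
      (((contMulAut c.G).subtype.comp (MonoidHom.fst (contMulAut c.G) PA)).comp
        (outerSemidirectProduct ρ).subtype)
      (baseAct.comp (outerSemidirectProductSnd ρ)))
    (w₀ : 𝒢.graph.Vertex) (hcpt : IsCompact (P.H w₀ : Set c.G))
    (N : ℕ → Subgroup c.G) (hNn : ∀ n, (N n).Normal)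
    (hNst : ∀ (n : ℕ) (e : outerSemidirectProduct ρ) (x : c.G), x ∈ N n →
      (((contMulAut c.G).subtype.comp (MonoidHom.fst (contMulAut c.G) PA)).comp
        (outerSemidirectProduct ρ).subtype) e x ∈ N n)
    (hNanti : Antitone N) (hNopen : ∀ n, IsOpen (N n : Set c.G))
    (hNcof : ∀ U ∈ 𝓝 (1 : c.G), ∃ n, (N n : Set c.G) ⊆ U)
    (hK1' : ∀ n, IsOpen (((P.levelKer hP (N n) (hNst n)).map (outerSemidirectProductSnd ρ) :
      Subgroup PA) : Set PA)) :
    ∃ (Gtp : Type u) (_ : Group Gtp) (_ : TopologicalSpace Gtp) (_ : IsTopologicalGroup Gtp)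
      (ι : c.G →ₜ* Gtp) (aug : Gtp →ₜ* PA),
      Function.Injective ι ∧ ι.toMonoidHom.range = aug.toMonoidHom.ker ∧ Function.Surjective aug ∧
      IsTempered Gtp ∧ IsEmbedding ι ∧ IsClosed (Set.range ι) ∧ IsOpenMap aug ∧
      ArithChartAction c ι.toMonoidHom aug.toMonoidHom
        (fun a v => (baseAct a).hom.vertexMap v) (fun a e => (baseAct a).hom.edgeMap e)
        (fun a b => (baseAct a).hom.branchMap b) := by
  -- the inner action `ι` sits inside `Φ` as conjugation and inside `σ` trivially
  have hιΦ : ∀ g : c.G,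
      (((contMulAut c.G).subtype.comp (MonoidHom.fst (contMulAut c.G) PA)).comp
        (outerSemidirectProduct ρ).subtype) (toOuterSemidirectProduct ρ g) = MulAut.conj g :=
    fun g => rfl
  have hισ : ∀ g : c.G,
      (baseAct.comp (outerSemidirectProductSnd ρ)) (toOuterSemidirectProduct ρ g) = 1 := fun g => by
    simp
  -- `π₁^temp(𝒢)` is Hausdorff (open normal subgroups separate points) and centre-free (temp-slim)
  haveI : T2Space c.G := by
    refine IsTopologicalGroup.t2Space_of_one_sep fun x hx => ?_
    obtain ⟨M, hM⟩ := c.isTempered.separated x hx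
    exact ⟨M, M.toOpenSubgroup.mem_nhds_one, hM⟩
  have hZ : Subgroup.center c.G = ⊥ := center_eq_bot_of_isSlimGroup (temperedPiSlim_holds 𝒢 h36 c)
  -- the level kernels
  refine exists_arithTemperedGroup_of_kernelSeq c ρ baseAct h36 hA hV hE hopen
    (fun n => P.levelKer hP (N n) (hNst n)) (fun m n hmn => ?_) (fun n => ?_) (fun n => ?_) hK1' ?_
  · exact P.levelKer_mono hP (hNst n) (hNst m) (hNanti hmn)
  · exact P.levelKer_normal hP (N n) (hNst n)
  · haveI := hNn n
    exact Subgroup.isOpen_mono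
      (P.le_comap_levelKer hP (N n) (hNst n) (toOuterSemidirectProduct ρ) hιΦ hισ) (hNopen n)
  · exact P.comap_levelKer_cofinal hP w₀ hcpt hZ N hNn hNst hNanti hNopen hNcof
      (toOuterSemidirectProduct ρ) hιΦ hισ

end ProfiniteSemiGraph

end Literature.AnabelianGeometry.SemiGraphs
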